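import Summits.ResolutionOfSingularities.ResolutionOfSingularities.Theorems.UniversalCellsCampaignW82SmoothTwistGradedProofs
import Literature.AlgebraicGeometry.Motives.GeometricallyReducedPerfectField
import Mathlib.AlgebraicGeometry.Geometrically.Reduced
import Mathlib.AlgebraicGeometry.Morphisms.Integral
import Mathlib.FieldTheory.PerfectClosure
import Mathlib.FieldTheory.IsPerfectClosure
import Mathlib.FieldTheory.IsAlgClosed.AlgebraicClosure
import HarnessLib

/-!
# [OURS · L1 W8.2] `IntegralOverPerfectClosure` = integral and geometrically reduced (Mathlib's notion) — proofs

Cell `res-hironaka`, LADDER-RESOLUTION rung L (RESCUE), slot W8.2, host route `UniversalCells`, host item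
`PrimeFieldToPerfect` (stmt-ResolutionOfSingularities-15233); prover res-L1-s82-pv-1 (gen 2). THESES-FREE.

The hypothesis predicate of the slot's normal forms, `CampaignW82.IntegralOverPerfectClosure K f₀` («`X₀ ×_K L` is
integral for some perfect purely inseparable `L ⊇ K`», statement file p481193), is identified with the standard
notion: `X₀` is integral and `f₀` is GEOMETRICALLY REDUCED in Mathlib's sense
(`AlgebraicGeometry.GeometricallyReduced`: every base change to a field is reduced).

WHAT IS PROVED (for `f₀ : X₀ ⟶ Spec K` locally of finite type and quasi-compact):
* `IntegralOverPerfectClosure.isIntegral` — `X₀` is integral (flat descent).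
* `IntegralOverPerfectClosure.geometricallyReduced` — `f₀` is geometrically reduced: for a field `F ⊇ K`
  embed the perfect purely inseparable witness `L` into an algebraic closure `Ω` of `F` over `K`
  (`IsAlgClosed.lift`); `X₀ ×_K Ω = (X₀ ×_K L) ×_L Ω` is reduced because `X₀ ×_K L` is reduced of finite type over
  the PERFECT `L` and `Spec Ω ⟶ Spec L` is geometrically reduced (EGA IV₂ 4.6.1, tree
  `Motives.geometricallyReduced_SpecMap_ringHom_of_perfectField`, with Mathlib
  `GeometricallyReduced.isReduced_of_flat_of_isLocallyNoetherian`); and reducedness descends along the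
  faithfully flat `X₀ ×_K Ω ⟶ X₀ ×_K F`.
* `integralOverPerfectClosure_of_geometricallyReduced` — conversely, for `K` of characteristic `p`, an integral
  `X₀` with `f₀` geometrically reduced is integral over the perfect closure: `X₀ ×_K K^{perf}` (Mathlib
  `PerfectClosure K p`) is reduced by definition of geometric reducedness and irreducible because
  `X₀ ×_K K^{perf} ⟶ X₀` is a continuous closed bijection (flat base change of the universally injective,
  integral, surjective `Spec K^{perf} ⟶ Spec K`).
* `integralOverPerfectClosure_iff` — the equivalence, for `K` of characteristic `p`.

So the slot's residual normal forms (`residual_normalForms_tfae`) quantify over exactly the integral,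
geometrically reduced `X₀` — Mathlib vocabulary; e.g. every integral `X₀` smooth over `K` qualifies (Mathlib
`geometricallyReduced_of_smooth`-type facts), and the disprover's witness `Spec K(t^{1/p})` does not.

HONEST FRAMING. OURS work of the rescue rung; no statement of the manuscript involved; no external premise.
AI work, weaker than expert review.

## References
* A. Grothendieck, J. Dieudonné, EGA IV₂ (1965), Prop. 4.6.1, Cor. 4.3.6. [GrothendieckDieudonne1965]
* The Stacks Project, Tags 035X, 054Q. [StacksProject]
-/

noncomputable section

set_option linter.dupNamespace false -- mandated namespace of this single-conjunct summit

open _root_.CategoryTheory _root_.CategoryTheory.Limits _root_.AlgebraicGeometry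
open Literature.AlgebraicGeometry.Resolution

namespace Summit.ResolutionOfSingularities.ResolutionOfSingularities.Theorems.CampaignW82

/-- **Integral over the perfect closure ⇒ integral** (flat descent along `X₀ ×_K L ⟶ X₀`). [folklore] -/
theorem IntegralOverPerfectClosure.isIntegral {K : Type} [Field K] {X₀ : Scheme.{0}}
    {f₀ : X₀ ⟶ Spec (.of K)} (h : IntegralOverPerfectClosure K f₀) : IsIntegral X₀ := by
  obtain ⟨L, _, _, _, _, hXL⟩ := h
  haveI := hXL
  haveI : Flat (pullback.fst f₀ (Spec.map (CommRingCat.ofHom (algebraMap K L)))) :=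
    MorphismProperty.pullback_fst _ _ (DeJong1996.Stage.flat_specMap _)
  haveI : Surjective (pullback.fst f₀ (Spec.map (CommRingCat.ofHom (algebraMap K L)))) :=
    MorphismProperty.pullback_fst _ _ (DeJong1996.Stage.surjective_specMap _)
  exact DeJong1996.Stage.isIntegral_of_flat_surjective
    (pullback.fst f₀ (Spec.map (CommRingCat.ofHom (algebraMap K L))))

/-- **Base change of a reduced scheme of finite type over a PERFECT field to any field is reduced**
(EGA IV₂ 4.6.1: `Spec Ω ⟶ Spec L` is geometrically reduced for `L` perfect — tree
`Motives.geometricallyReduced_SpecMap_ringHom_of_perfectField` — and flat; Mathlib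
`GeometricallyReduced.isReduced_of_flat_of_isLocallyNoetherian`). [cite: GrothendieckDieudonne1965, Prop. (4.6.1), p. 68] -/
theorem isReduced_pullback_specMap_of_perfectField {L Ω : Type} [Field L] [PerfectField L] [Field Ω]
    (ψ : L →+* Ω) {X : Scheme.{0}} (g : X ⟶ Spec (.of L)) [LocallyOfFiniteType g] [IsReduced X] :
    IsReduced (pullback g (Spec.map (CommRingCat.ofHom ψ))) := by
  haveI : GeometricallyReduced (Spec.map (CommRingCat.ofHom ψ)) :=
    Literature.AlgebraicGeometry.Motives.geometricallyReduced_SpecMap_ringHom_of_perfectField ψ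
  haveI : Flat (Spec.map (CommRingCat.ofHom ψ)) := DeJong1996.Stage.flat_specMap ψ
  haveI : IsLocallyNoetherian X := LocallyOfFiniteType.isLocallyNoetherian g
  infer_instance

/-- **Integral over the perfect closure ⇒ geometrically reduced** (Mathlib `GeometricallyReduced f₀`). For a
field `F ⊇ K`, embed the perfect purely inseparable witness `L` over `K` into an algebraic closure `Ω` of `F`
(`IsAlgClosed.lift`); then `X₀ ×_K Ω ≅ (X₀ ×_K L) ×_L Ω` is reduced (`isReduced_pullback_specMap_of_perfectField`)
and `X₀ ×_K Ω ⟶ X₀ ×_K F` is flat and surjective, so `X₀ ×_K F` is reduced. [folklore] -/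
theorem IntegralOverPerfectClosure.geometricallyReduced {K : Type} [Field K] {X₀ : Scheme.{0}}
    {f₀ : X₀ ⟶ Spec (.of K)} [LocallyOfFiniteType f₀] (h : IntegralOverPerfectClosure K f₀) :
    GeometricallyReduced f₀ := by
  obtain ⟨L, _, _, _, _, hXL⟩ := h
  haveI := hXL
  haveI : Algebra.IsAlgebraic K L := IsPurelyInseparable.isAlgebraic K L
  rw [geometricallyReduced_iff, geometrically_iff_of_commRing_of_isClosedUnderIsomorphisms]
  intro F _ _
  -- an algebraic closure `Ω` of `F`, as a `K`-algebra through `F`, and `ψ : L →ₐ[K] Ω`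
  let Ω := AlgebraicClosure F
  let ψ : L →ₐ[K] Ω := IsAlgClosed.lift
  have hψ : ψ.toRingHom.comp (algebraMap K L) = algebraMap K Ω := ψ.comp_algebraMap
  have hΩ : (algebraMap F Ω).comp (algebraMap K F) = algebraMap K Ω :=
    (IsScalarTower.algebraMap_eq K F Ω).symm
  -- `X₀ ×_K Ω` in the two presentations
  have eL : Spec.map (CommRingCat.ofHom ψ.toRingHom) ≫ Spec.map (CommRingCat.ofHom (algebraMap K L)) =
      Spec.map (CommRingCat.ofHom (algebraMap K Ω)) := by
    rw [← Spec.map_comp, ← CommRingCat.ofHom_comp, hψ]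
  have eF : Spec.map (CommRingCat.ofHom (algebraMap F Ω)) ≫ Spec.map (CommRingCat.ofHom (algebraMap K F)) =
      Spec.map (CommRingCat.ofHom (algebraMap K Ω)) := by
    rw [← Spec.map_comp, ← CommRingCat.ofHom_comp, hΩ]
  -- `(X₀ ×_K L) ×_L Ω` is reduced (perfect `L`)
  haveI : IsReduced (pullback (pullback.snd f₀ (Spec.map (CommRingCat.ofHom (algebraMap K L))))
      (Spec.map (CommRingCat.ofHom ψ.toRingHom))) :=
    isReduced_pullback_specMap_of_perfectField ψ.toRingHom _
  -- hence `(X₀ ×_K F) ×_F Ω ≅ X₀ ×_K Ω ≅ (X₀ ×_K L) ×_L Ω` is reduced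
  let ε : pullback (pullback.snd f₀ (Spec.map (CommRingCat.ofHom (algebraMap K L))))
        (Spec.map (CommRingCat.ofHom ψ.toRingHom)) ≅
      pullback (pullback.snd f₀ (Spec.map (CommRingCat.ofHom (algebraMap K F))))
        (Spec.map (CommRingCat.ofHom (algebraMap F Ω))) :=
    (pullbackLeftPullbackSndIso f₀ _ _ ≪≫ pullback.congrHom rfl eL) ≪≫
      (pullbackLeftPullbackSndIso f₀ _ _ ≪≫ pullback.congrHom rfl eF).symm
  haveI : IsReduced (pullback (pullback.snd f₀ (Spec.map (CommRingCat.ofHom (algebraMap K F))))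
      (Spec.map (CommRingCat.ofHom (algebraMap F Ω)))) :=
    isReduced_of_isOpenImmersion ε.inv
  -- and `(X₀ ×_K F) ×_F Ω → X₀ ×_K F` is flat and surjective
  haveI : Flat (pullback.fst (pullback.snd f₀ (Spec.map (CommRingCat.ofHom (algebraMap K F))))
      (Spec.map (CommRingCat.ofHom (algebraMap F Ω)))) :=
    MorphismProperty.pullback_fst _ _ (DeJong1996.Stage.flat_specMap _)
  haveI : Surjective (pullback.fst (pullback.snd f₀ (Spec.map (CommRingCat.ofHom (algebraMap K F))))
      (Spec.map (CommRingCat.ofHom (algebraMap F Ω)))) :=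
    MorphismProperty.pullback_fst _ _ (DeJong1996.Stage.surjective_specMap _)
  exact DeJong1996.Stage.isReduced_of_flat_surjective
    (pullback.fst (pullback.snd f₀ (Spec.map (CommRingCat.ofHom (algebraMap K F))))
      (Spec.map (CommRingCat.ofHom (algebraMap F Ω))))

/-- **Integral and geometrically reduced ⇒ integral over the perfect closure** (characteristic `p`): the
base change to Mathlib's `PerfectClosure K p` is reduced by geometric reducedness and irreducible because
`X₀ ×_K K^{perf} ⟶ X₀` is a continuous closed bijection — the flat base change of `Spec K^{perf} ⟶ Spec K`,
which is surjective, universally injective (purely inseparable) and universally closed (integral).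
[folklore] -/
theorem integralOverPerfectClosure_of_geometricallyReduced (p : ℕ) [Fact p.Prime] {K : Type} [Field K]
    [CharP K p] {X₀ : Scheme.{0}} (f₀ : X₀ ⟶ Spec (.of K)) [IsIntegral X₀] [GeometricallyReduced f₀] :
    IntegralOverPerfectClosure K f₀ := by
  let L := PerfectClosure K p
  letI : Algebra K L := (PerfectClosure.of K p).toAlgebra
  haveI : IsPRadical (algebraMap K L) p := inferInstanceAs (IsPRadical (PerfectClosure.of K p) p)
  haveI : IsPurelyInseparable K L := IsPRadical.isPurelyInseparable K L p
  refine ⟨L, inferInstance, inferInstance, inferInstance, inferInstance, ?_⟩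
  -- reduced: geometric reducedness
  haveI : IsReduced (pullback f₀ (Spec.map (CommRingCat.ofHom (algebraMap K L)))) :=
    pullback_of_geometrically (GeometricallyReduced.geometrically_isReduced (f := f₀)) L _
  -- irreducible: `t : X₀ ×_K L → X₀` is a closed continuous bijection
  let t := pullback.fst f₀ (Spec.map (CommRingCat.ofHom (algebraMap K L)))
  haveI : Surjective t := MorphismProperty.pullback_fst _ _ (DeJong1996.Stage.surjective_specMap _)
  haveI : UniversallyInjective t := MorphismProperty.pullback_fst _ _
    (Summit.ResolutionOfSingularities.ResolutionOfSingularities.Theorems.universallyInjective_SpecMap_of_isPurelyInseparable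
      K L)
  haveI : IsIntegralHom (Spec.map (CommRingCat.ofHom (algebraMap K L))) :=
    IsIntegralHom.SpecMap_iff.mpr Algebra.IsIntegral.isIntegral
  haveI : UniversallyClosed t := MorphismProperty.pullback_fst _ _ inferInstance
  have hce : Topology.IsClosedEmbedding t :=
    .of_continuous_injective_isClosedMap t.continuous t.injective t.isClosedMap
  have hrange : Set.range t = Set.univ := t.surjective.range_eq
  let e : ↥(pullback f₀ (Spec.map (CommRingCat.ofHom (algebraMap K L)))) ≃ₜ ↥X₀ :=
    hce.isEmbedding.toHomeomorph.trans ((Homeomorph.setCongr hrange).trans (Homeomorph.Set.univ _))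
  haveI : IrreducibleSpace ↥(pullback f₀ (Spec.map (CommRingCat.ofHom (algebraMap K L)))) :=
    e.irreducibleSpace_iff.2 inferInstance
  exact isIntegral_of_irreducibleSpace_of_isReduced _

/-- **`IntegralOverPerfectClosure K f₀ ↔ IsIntegral X₀ ∧ GeometricallyReduced f₀`** for `f₀ : X₀ ⟶ Spec K`
locally of finite type over a field of characteristic `p` — the hypothesis of the slot's normal forms is
«integral and geometrically reduced» in Mathlib's vocabulary (NOT «geometrically integral»: geometric
irreducibility is not asked). [folklore] -/
theorem integralOverPerfectClosure_iff (p : ℕ) [Fact p.Prime] {K : Type} [Field K] [CharP K p]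
    {X₀ : Scheme.{0}} (f₀ : X₀ ⟶ Spec (.of K)) [LocallyOfFiniteType f₀] :
    IntegralOverPerfectClosure K f₀ ↔ IsIntegral X₀ ∧ GeometricallyReduced f₀ :=
  ⟨fun h => ⟨h.isIntegral, h.geometricallyReduced⟩,
    fun ⟨_, _⟩ => integralOverPerfectClosure_of_geometricallyReduced p f₀⟩

/-! ## v2 (append-only): «some perfect purely inseparable witness» = «every purely inseparable extension»

Everything above this line is byte-identical with v1 (p486897). Appended by res-L1-s82-pv-1 (gen 2). -/

/-- **A purely inseparable ground field extension does not change the topology**: for `L/K` purely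
inseparable and any `K`-scheme `X₀`, the projection `X₀ ×_K Spec L ⟶ X₀` is a continuous closed bijection
(surjective and flat as a base change of `Spec L ⟶ Spec K`, universally injective because `L/K` is purely
inseparable, universally closed because `L/K` is integral); in particular `X₀ ×_K Spec L` is irreducible when
`X₀` is. [folklore] -/
theorem irreducibleSpace_pullback_of_isPurelyInseparable {K L : Type} [Field K] [Field L] [Algebra K L]
    [IsPurelyInseparable K L] {X₀ : Scheme.{0}} (f₀ : X₀ ⟶ Spec (.of K)) [IrreducibleSpace X₀] :
    IrreducibleSpace ↥(pullback f₀ (Spec.map (CommRingCat.ofHom (algebraMap K L)))) := by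
  let t := pullback.fst f₀ (Spec.map (CommRingCat.ofHom (algebraMap K L)))
  haveI : Surjective t := MorphismProperty.pullback_fst _ _ (DeJong1996.Stage.surjective_specMap _)
  haveI : UniversallyInjective t := MorphismProperty.pullback_fst _ _
    (Summit.ResolutionOfSingularities.ResolutionOfSingularities.Theorems.universallyInjective_SpecMap_of_isPurelyInseparable
      K L)
  haveI : IsIntegralHom (Spec.map (CommRingCat.ofHom (algebraMap K L))) :=
    IsIntegralHom.SpecMap_iff.mpr Algebra.IsIntegral.isIntegral
  haveI : UniversallyClosed t := MorphismProperty.pullback_fst _ _ inferInstance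
  have hce : Topology.IsClosedEmbedding t :=
    .of_continuous_injective_isClosedMap t.continuous t.injective t.isClosedMap
  have hrange : Set.range t = Set.univ := t.surjective.range_eq
  let e : ↥(pullback f₀ (Spec.map (CommRingCat.ofHom (algebraMap K L)))) ≃ₜ ↥X₀ :=
    hce.isEmbedding.toHomeomorph.trans ((Homeomorph.setCongr hrange).trans (Homeomorph.Set.univ _))
  exact e.irreducibleSpace_iff.2 inferInstance

/-- **Integral and geometrically reduced ⇒ integral over EVERY purely inseparable extension** (finite or
not, perfect or not): reduced by geometric reducedness, irreducible by
`irreducibleSpace_pullback_of_isPurelyInseparable`. [folklore] -/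
theorem isIntegral_pullback_of_geometricallyReduced_of_isPurelyInseparable {K : Type} [Field K]
    {X₀ : Scheme.{0}} (f₀ : X₀ ⟶ Spec (.of K)) [IsIntegral X₀] [GeometricallyReduced f₀]
    (L : Type) [Field L] [Algebra K L] [IsPurelyInseparable K L] :
    IsIntegral (pullback f₀ (Spec.map (CommRingCat.ofHom (algebraMap K L)))) := by
  haveI : IsReduced (pullback f₀ (Spec.map (CommRingCat.ofHom (algebraMap K L)))) :=
    pullback_of_geometrically (GeometricallyReduced.geometrically_isReduced (f := f₀)) L _
  haveI := irreducibleSpace_pullback_of_isPurelyInseparable (L := L) f₀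
  exact isIntegral_of_irreducibleSpace_of_isReduced _

/-- **«Some perfect purely inseparable witness» gives «every purely inseparable extension»**: if
`IntegralOverPerfectClosure K f₀` holds (for `f₀` locally of finite type), then `X₀ ×_K Spec L'` is integral for
EVERY purely inseparable `L' ⊇ K` — in particular at every finite level `K^{1/p^e}` of the Frobenius-root climb
and over every perfect closure. (`IntegralOverPerfectClosure.isIntegral` + `.geometricallyReduced` +
`isIntegral_pullback_of_geometricallyReduced_of_isPurelyInseparable`.) [folklore] -/
theorem IntegralOverPerfectClosure.isIntegral_pullback {K : Type} [Field K] {X₀ : Scheme.{0}}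
    {f₀ : X₀ ⟶ Spec (.of K)} [LocallyOfFiniteType f₀] (h : IntegralOverPerfectClosure K f₀)
    (L' : Type) [Field L'] [Algebra K L'] [IsPurelyInseparable K L'] :
    IsIntegral (pullback f₀ (Spec.map (CommRingCat.ofHom (algebraMap K L')))) := by
  haveI := h.isIntegral
  haveI := h.geometricallyReduced
  exact isIntegral_pullback_of_geometricallyReduced_of_isPurelyInseparable f₀ L'

end Summit.ResolutionOfSingularities.ResolutionOfSingularities.Theorems.CampaignW82

end
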